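import Summits.MatrixMultiplication.OmegaCensus.STPPVosperTilingWordsSound

/-!
# ω-census (abelian STPP census): the exact-cover checker with words over a GENERAL sound block enumerator (kernel)

HONEST FRAMING (pub-omega census; verbatim): lottery ticket; floor = certified bounds/negative ranges.
Census STRUCTURE (seat pub-omega-stpp-1 gen 32, 2026-08-28), family (b2).  `existsCoverW p YL ZL cands uY uZ uX` (`STPPVosperTilingWords.lean`) searches over
PRECOMPUTED per-block candidate lists; its list-level soundness `existsCoverW_complete_list` only needs that the value triple of every real block is a
member of its candidate list.  This file names that property of a block enumerator `bd YL ZL a b c` — `BlockEnumSound p bd`: every block of sizes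
`(a,b,c)` with `0 ∈ B`, `C − B ⊆ YL`, `C − A ⊆ ZL`, injective difference maps and the three within-block Def-5.1 words is realised (by lists enumerating its
value finsets) inside `bd YL ZL a b c` — proves it for `blockDiffsW` (`blockEnumSound_blockDiffsW`, = `exists_lists_mem_blockDiffsW`), and restates the
finset-level soundness theorem for any sound enumerator (`existsCoverW_complete_enum`).  So laws can be stated once for an arbitrary sound `bd` and faster
enumerators (e.g. the pruned `blockDiffsWP`, `STPPVosperTilingWordsPruned.lean`) plug in without touching them.  UNCONDITIONAL.  Nothing here is progress on `ω`.

References: H. Cohn, R. Kleinberg, B. Szegedy, C. Umans, FOCS 2005 (arXiv:math/0511460), Def. 5.1.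
-/

open Finset
open scoped Pointwise

namespace Summit.MatrixMultiplication.OmegaCensus.CubeNB

open Literature.Computability.AlgebraicComplexity
open Literature.Combinatorics.Additive
open Summit.MatrixMultiplication.OmegaCensus.STPPKneser

/-! ## §1 Sound block enumerators -/

section Enum

/-- A block enumerator `bd YL ZL a b c` (candidate value triples `(C − B, C − A, A − B)` of one block of sizes `(a,b,c)` against the Y-points `YL` and the
Z-points `ZL`) is SOUND if every block with value finsets `Av, Bv, Cv ⊆ [0, p)` of these sizes, `0 ∈ Bv`, all `(c − x) mod p` (`x ∈ Bv`) in the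
duplicate-free `YL`, all `(c − x) mod p` (`x ∈ Av`) in `ZL`, injective difference maps and the three within-block Def-5.1 words, is realised in it by lists
enumerating the three finsets. [folklore] -/
def BlockEnumSound (p : ℕ) (bd : List ℕ → List ℕ → ℕ → ℕ → ℕ → List (List ℕ × List ℕ × List ℕ)) : Prop :=
  ∀ (YL ZL : List ℕ), YL.Nodup → ∀ (a b c : ℕ) (Av Bv Cv : Finset ℕ), #Av = a → #Bv = b → #Cv = c →
    (∀ x ∈ Av, x < p) → (∀ x ∈ Bv, x < p) → (∀ x ∈ Cv, x < p) → 0 ∈ Bv →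
    (∀ c ∈ Cv, ∀ x ∈ Bv, (c + p - x) % p ∈ YL) → (∀ c ∈ Cv, ∀ x ∈ Av, (c + p - x) % p ∈ ZL) →
    (∀ c ∈ Cv, ∀ c' ∈ Cv, ∀ x ∈ Bv, ∀ x' ∈ Bv, (c + p - x) % p = (c' + p - x') % p → c = c' ∧ x = x') →
    (∀ c ∈ Cv, ∀ c' ∈ Cv, ∀ x ∈ Av, ∀ x' ∈ Av, (c + p - x) % p = (c' + p - x') % p → c = c' ∧ x = x') →
    (∀ c ∈ Av, ∀ c' ∈ Av, ∀ x ∈ Bv, ∀ x' ∈ Bv, (c + p - x) % p = (c' + p - x') % p → c = c' ∧ x = x') →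
    (∀ a₁ ∈ Av, ∀ a₂ ∈ Av, a₁ ≠ a₂ → ∀ y ∈ Bv, ∀ c ∈ Cv, ((a₁ + p - y) % p + (c + p - a₂) % p) % p ∉ YL) →
    (∀ b₁ ∈ Bv, ∀ b₂ ∈ Bv, b₁ ≠ b₂ → ∀ c ∈ Cv, ∀ x ∈ Av, ((c + p - b₁) % p + p - (x + p - b₂) % p) % p ∉ ZL) →
    (∀ c₁ ∈ Cv, ∀ c₂ ∈ Cv, c₁ ≠ c₂ → ∀ y ∈ Bv, ∀ x ∈ Av, ∀ x' ∈ Av, ∀ y' ∈ Bv,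
      ((c₁ + p - y) % p + p - (c₂ + p - x) % p) % p ≠ (x' + p - y') % p) →
    ∃ Al Bl Cl : List ℕ, (∀ x, x ∈ Al ↔ x ∈ Av) ∧ (∀ x, x ∈ Bl ↔ x ∈ Bv) ∧ (∀ x, x ∈ Cl ↔ x ∈ Cv) ∧
      (diffList p Cl Bl, diffList p Cl Al, diffList p Al Bl) ∈ bd YL ZL a b c

/-- `blockDiffsW` is a sound block enumerator (`exists_lists_mem_blockDiffsW`). [folklore] -/
theorem blockEnumSound_blockDiffsW (p : ℕ) : BlockEnumSound p (blockDiffsW p) :=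
  fun _ _ hYL _ _ _ Av Bv Cv hszA hszB hszC hAp hBp hCp hB0 hY hZ hinjY hinjZ hinjX hw1 hw2 hw3 =>
    exists_lists_mem_blockDiffsW hYL Av Bv Cv hszA hszB hszC hAp hBp hCp hB0 hY hZ hinjY hinjZ hinjX hw1 hw2 hw3

end Enum

/-! ## §2 Soundness of the checker over a sound enumerator -/

section Sound

variable {ι : Type*}

/-- **Soundness of the exact-cover checker with words over ANY sound block enumerator.**  Blocks `k` (`good k`) with value finsets `Av k, Bv k, Cv k ⊆ [0, p)` of sizes `sz k = (a,b,c)`,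
`0 ∈ Bv k`, all `(c − x) mod p` (`c ∈ Cv k`, `x ∈ Bv k`) among the duplicate-free Y-points `YL`, all `(c − x) mod p` (`x ∈ Av k`) among `ZL`, the three
difference maps injective, the Def-5.1 words (`(a″ − b″) + (c′ − a′) ∉ YL` unless same block and `a″ = a′`; `(c − b) − (a″ − b″) ∉ ZL` unless same block and
`b = b″`; `(c − b) − (c′ − a′) ≠ a″ − b″` unless all three blocks coincide and `c = c′`), the difference sets of distinct blocks pairwise disjoint
(this is the case `l ≠ k` etc. of the words together with injectivity, but we assume it explicitly), and the Y- (Z-) difference sets covering `YL` (`ZL`):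
then `existsCoverW p YL ZL (ks.map fun k => bd YL ZL a_k b_k c_k) [] [] [] = true` for every duplicate-free list `ks` of exactly the good blocks and every
sound block enumerator `bd`.
[cite: CohnKleinbergSzegedyUmans2005, Def. 5.1] -/
theorem existsCoverW_complete_enum {p : ℕ} {bd : List ℕ → List ℕ → ℕ → ℕ → ℕ → List (List ℕ × List ℕ × List ℕ)}
    (hbd : BlockEnumSound p bd) {YL ZL : List ℕ} (hYL : YL.Nodup) (good : ι → Prop)
    (sz : ι → ℕ × ℕ × ℕ) (Av Bv Cv : ι → Finset ℕ)
    (hszA : ∀ k, good k → #(Av k) = (sz k).1) (hszB : ∀ k, good k → #(Bv k) = (sz k).2.1) (hszC : ∀ k, good k → #(Cv k) = (sz k).2.2)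
    (hAp : ∀ k, ∀ x ∈ Av k, x < p) (hBp : ∀ k, ∀ x ∈ Bv k, x < p) (hCp : ∀ k, ∀ x ∈ Cv k, x < p) (hB0 : ∀ k, good k → 0 ∈ Bv k)
    (hY : ∀ k, good k → ∀ c ∈ Cv k, ∀ x ∈ Bv k, (c + p - x) % p ∈ YL) (hZ : ∀ k, good k → ∀ c ∈ Cv k, ∀ x ∈ Av k, (c + p - x) % p ∈ ZL)
    (hinjY : ∀ k, good k → ∀ c ∈ Cv k, ∀ c' ∈ Cv k, ∀ x ∈ Bv k, ∀ x' ∈ Bv k, (c + p - x) % p = (c' + p - x') % p → c = c' ∧ x = x')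
    (hinjZ : ∀ k, good k → ∀ c ∈ Cv k, ∀ c' ∈ Cv k, ∀ x ∈ Av k, ∀ x' ∈ Av k, (c + p - x) % p = (c' + p - x') % p → c = c' ∧ x = x')
    (hinjX : ∀ k, good k → ∀ c ∈ Av k, ∀ c' ∈ Av k, ∀ x ∈ Bv k, ∀ x' ∈ Bv k, (c + p - x) % p = (c' + p - x') % p → c = c' ∧ x = x')
    (hdY : ∀ k k', good k → good k' → k ≠ k' → ∀ c ∈ Cv k, ∀ x ∈ Bv k, ∀ c' ∈ Cv k', ∀ x' ∈ Bv k', (c + p - x) % p ≠ (c' + p - x') % p)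
    (hdZ : ∀ k k', good k → good k' → k ≠ k' → ∀ c ∈ Cv k, ∀ x ∈ Av k, ∀ c' ∈ Cv k', ∀ x' ∈ Av k', (c + p - x) % p ≠ (c' + p - x') % p)
    (hdX : ∀ k k', good k → good k' → k ≠ k' → ∀ c ∈ Av k, ∀ x ∈ Bv k, ∀ c' ∈ Av k', ∀ x' ∈ Bv k', (c + p - x) % p ≠ (c' + p - x') % p)
    (hwXZ : ∀ l k, good l → good k → ∀ a₁ ∈ Av l, ∀ y ∈ Bv l, ∀ c ∈ Cv k, ∀ a₂ ∈ Av k, ¬(l = k ∧ a₁ = a₂) →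
      ((a₁ + p - y) % p + (c + p - a₂) % p) % p ∉ YL)
    (hwYX : ∀ j l, good j → good l → ∀ c ∈ Cv j, ∀ b₁ ∈ Bv j, ∀ x ∈ Av l, ∀ b₂ ∈ Bv l, ¬(j = l ∧ b₁ = b₂) →
      ((c + p - b₁) % p + p - (x + p - b₂) % p) % p ∉ ZL)
    (hwYZ : ∀ j k l, good j → good k → good l → ∀ c₁ ∈ Cv j, ∀ y ∈ Bv j, ∀ c₂ ∈ Cv k, ∀ x ∈ Av k, ∀ x' ∈ Av l, ∀ y' ∈ Bv l,
      ¬(j = k ∧ k = l ∧ c₁ = c₂) → ((c₁ + p - y) % p + p - (c₂ + p - x) % p) % p ≠ (x' + p - y') % p)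
    (hcY : ∀ y ∈ YL, ∃ k, good k ∧ ∃ c ∈ Cv k, ∃ x ∈ Bv k, (c + p - x) % p = y)
    (hcZ : ∀ t ∈ ZL, ∃ k, good k ∧ ∃ c ∈ Cv k, ∃ x ∈ Av k, (c + p - x) % p = t)
    (ks : List ι) (hks : ks.Nodup) (hksg : ∀ k, k ∈ ks ↔ good k) :
    existsCoverW p YL ZL (ks.map fun k => bd YL ZL (sz k).1 (sz k).2.1 (sz k).2.2) [] [] [] = true := by
  classical
  -- lists realising every good block
  have hex : ∀ k, ∃ L3 : List ℕ × List ℕ × List ℕ, good k →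
      (∀ x, x ∈ L3.1 ↔ x ∈ Av k) ∧ (∀ x, x ∈ L3.2.1 ↔ x ∈ Bv k) ∧ (∀ x, x ∈ L3.2.2 ↔ x ∈ Cv k) ∧
      (diffList p L3.2.2 L3.2.1, diffList p L3.2.2 L3.1, diffList p L3.1 L3.2.1) ∈ bd YL ZL (sz k).1 (sz k).2.1 (sz k).2.2 := by
    intro k
    by_cases hg : good k
    · obtain ⟨Al, Bl, Cl, hA, hB, hC, hmem⟩ := hbd YL ZL hYL _ _ _ (Av k) (Bv k) (Cv k) (hszA k hg) (hszB k hg) (hszC k hg)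
        (hAp k) (hBp k) (hCp k) (hB0 k hg) (hY k hg) (hZ k hg) (hinjY k hg) (hinjZ k hg) (hinjX k hg)
        (fun a₁ ha₁ a₂ ha₂ hne y hy c hc => hwXZ k k hg hg a₁ ha₁ y hy c hc a₂ ha₂ (fun h => hne h.2))
        (fun b₁ hb₁ b₂ hb₂ hne c hc x hx => hwYX k k hg hg c hc b₁ hb₁ x hx b₂ hb₂ (fun h => hne h.2))
        (fun c₁ hc₁ c₂ hc₂ hne y hy x hx x' hx' y' hy' => hwYZ k k k hg hg hg c₁ hc₁ y hy c₂ hc₂ x hx x' hx' y' hy' (fun h => hne h.2.2))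
      exact ⟨(Al, Bl, Cl), fun _ => ⟨hA, hB, hC, hmem⟩⟩
    · exact ⟨([], [], []), fun h => absurd h hg⟩
  choose L3 hL3 using hex
  -- membership in the difference lists
  have hDY : ∀ k, good k → ∀ y, y ∈ diffList p (L3 k).2.2 (L3 k).2.1 ↔ ∃ c ∈ Cv k, ∃ x ∈ Bv k, (c + p - x) % p = y := by
    intro k hg y
    rw [mem_diffList]
    constructor
    · rintro ⟨c, hc, x, hx, h⟩; exact ⟨c, ((hL3 k hg).2.2.1 c).1 hc, x, ((hL3 k hg).2.1 x).1 hx, h⟩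
    · rintro ⟨c, hc, x, hx, h⟩; exact ⟨c, ((hL3 k hg).2.2.1 c).2 hc, x, ((hL3 k hg).2.1 x).2 hx, h⟩
  have hDZ : ∀ k, good k → ∀ t, t ∈ diffList p (L3 k).2.2 (L3 k).1 ↔ ∃ c ∈ Cv k, ∃ x ∈ Av k, (c + p - x) % p = t := by
    intro k hg t
    rw [mem_diffList]
    constructor
    · rintro ⟨c, hc, x, hx, h⟩; exact ⟨c, ((hL3 k hg).2.2.1 c).1 hc, x, ((hL3 k hg).1 x).1 hx, h⟩
    · rintro ⟨c, hc, x, hx, h⟩; exact ⟨c, ((hL3 k hg).2.2.1 c).2 hc, x, ((hL3 k hg).1 x).2 hx, h⟩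
  have hDX : ∀ k, good k → ∀ x, x ∈ diffList p (L3 k).1 (L3 k).2.1 ↔ ∃ c ∈ Av k, ∃ y ∈ Bv k, (c + p - y) % p = x := by
    intro k hg x
    rw [mem_diffList]
    constructor
    · rintro ⟨c, hc, y, hy, h⟩; exact ⟨c, ((hL3 k hg).1 c).1 hc, y, ((hL3 k hg).2.1 y).1 hy, h⟩
    · rintro ⟨c, hc, y, hy, h⟩; exact ⟨c, ((hL3 k hg).1 c).2 hc, y, ((hL3 k hg).2.1 y).2 hy, h⟩
  have hmain := existsCoverW_complete_list (p := p) (YL := YL) (ZL := ZL) good (fun k => (L3 k).1) (fun k => (L3 k).2.1) (fun k => (L3 k).2.2)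
    (fun k => bd YL ZL (sz k).1 (sz k).2.1 (sz k).2.2) (fun k hg => (hL3 k hg).2.2.2) ?_ ?_ ?_ ?_ ?_ ?_ ?_ ?_ ks hks (fun k hk => (hksg k).1 hk)
    [] [] [] (by simp) (by simp) (by simp) (fun k hg hk => absurd ((hksg k).2 hg) hk) (fun k hg hk => absurd ((hksg k).2 hg) hk)
  · exact hmain
  · intro k k' hg hg' hne y hy hy'
    obtain ⟨c, hc, x, hx, rfl⟩ := (hDY k hg y).1 hy
    obtain ⟨c', hc', x', hx', h⟩ := (hDY k' hg' _).1 hy'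
    exact hdY k k' hg hg' hne c hc x hx c' hc' x' hx' h.symm
  · intro k k' hg hg' hne t ht ht'
    obtain ⟨c, hc, x, hx, rfl⟩ := (hDZ k hg t).1 ht
    obtain ⟨c', hc', x', hx', h⟩ := (hDZ k' hg' _).1 ht'
    exact hdZ k k' hg hg' hne c hc x hx c' hc' x' hx' h.symm
  · intro k k' hg hg' hne x hx hx'
    obtain ⟨c, hc, y, hy, rfl⟩ := (hDX k hg x).1 hx
    obtain ⟨c', hc', y', hy', h⟩ := (hDX k' hg' _).1 hx'
    exact hdX k k' hg hg' hne c hc y hy c' hc' y' hy' h.symm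
  · intro l k hgl hgk hne x hx t ht
    obtain ⟨a₁, ha₁, y, hy, rfl⟩ := (hDX l hgl x).1 hx
    obtain ⟨c, hc, a₂, ha₂, rfl⟩ := (hDZ k hgk t).1 ht
    exact hwXZ l k hgl hgk a₁ ha₁ y hy c hc a₂ ha₂ (fun h => hne h.1)
  · intro j l hgj hgl hne y hy x hx
    obtain ⟨c, hc, b₁, hb₁, rfl⟩ := (hDY j hgj y).1 hy
    obtain ⟨x', hx', b₂, hb₂, rfl⟩ := (hDX l hgl x).1 hx
    exact hwYX j l hgj hgl c hc b₁ hb₁ x' hx' b₂ hb₂ (fun h => hne h.1)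
  · intro j k l hgj hgk hgl hne y hy t ht hmem
    obtain ⟨c₁, hc₁, y', hy', rfl⟩ := (hDY j hgj y).1 hy
    obtain ⟨c₂, hc₂, x, hx, rfl⟩ := (hDZ k hgk t).1 ht
    obtain ⟨x', hx', y'', hy'', h⟩ := (hDX l hgl _).1 hmem
    exact hwYZ j k l hgj hgk hgl c₁ hc₁ y' hy' c₂ hc₂ x hx x' hx' y'' hy'' (fun h' => hne ⟨h'.1, h'.2.1⟩) h.symm
  · intro y hy
    obtain ⟨k, hg, h⟩ := hcY y hy
    exact ⟨k, hg, (hDY k hg y).2 h⟩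
  · intro t ht
    obtain ⟨k, hg, h⟩ := hcZ t ht
    exact ⟨k, hg, (hDZ k hg t).2 h⟩

end Sound

end Summit.MatrixMultiplication.OmegaCensus.CubeNB
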